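import Mathlib
import Summits.ValiantsHypothesis.ValiantsHypothesis.Theorems.FifoMatchingNNDivisionHardGrandResidualArcs
import Summits.ValiantsHypothesis.ValiantsHypothesis.Theorems.FifoMatchingNNDivisionHardNewtonDimension
import HarnessLib

/-!
# Route FifoMatching — crux `NNDivisionHard` (stmt-ValiantsHypothesis-21181): the GRAND RESIDUAL ∧ BOUNDED-ARC-SET
# NON-GENERIC ∧ HIGH NEWTON DIMENSION — one residual of record, by name

`…GrandResidualArcs.nnDivisionHard_iff_grandResidualArcs` (✓ p832541): 21181 ⟺ the inequality for cofactors that are cheap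
∧ torus-homogeneous ∧ window-dense ∧ deep ∧ spread ∧ undominated ∧ non-generic for every arc set of size `≤ k`.
`…NewtonDimension.newtonDim_not_certificate_qp`: a cofactor whose Newton polytope has dimension `D` with `(D + 1)² ≤ n` is not
a certificate (the arc-by-arc descent of free initial forms).  Since the grand residual's `⟸` already normalises an arbitrary
certificate INTO the residual class, the new conjunct intersects for free (the dimension test is applied to the residual
member itself):

* ★ BY NAME `nnDivisionHard_iff_grandResidualArcsDim` — **`Theses.FifoMatching.NNDivisionHard` ⟺ for all `k c`, eventually
  in `n`, every `h ≠ 0` that is cheap, torus-homogeneous, window-dense, deep, spread, undominated, non-generic for every arc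
  set of size `≤ k` AND of HIGH NEWTON DIMENSION (`n < (dim aff supp h + 1)²`, the dimension read in `ℚ^{arcs}`) satisfies
  `2^((log₂ n + c)^c) < L₊(NN_n · h) + L₊(h)`.**

HONEST FRAMING: residual book-keeping BY NAME; `NNDivisionHard`, `NNNotVP`, VP ≠ VNP stay OPEN (NOT proved).  No definitions,
no named facts.  References: Hrubeš–Yehudayoff 2021 §6 Problem 2 [HrubesYehudayoff2021].
-/

noncomputable section

-- Sub = Summit single-conjunct layout: the duplicated namespace component is mandated by the tree.
set_option linter.dupNamespace false
set_option autoImplicit false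

namespace Summit.ValiantsHypothesis.ValiantsHypothesis.Theorems.FifoMatching.NNDivisionHard.GrandResidualArcsDim

open MvPolynomial Finset Literature.Computability.AlgebraicComplexity
open scoped NNReal BigOperators Classical
open Summit.ValiantsHypothesis.ValiantsHypothesis.Theorems.ZeroOneTransfer.Negative (topComponent)
open Summit.ValiantsHypothesis.ValiantsHypothesis.Theorems.FifoMatching.NNLowDegreeCofactorHard (vertexDeg)
open Summit.ValiantsHypothesis.ValiantsHypothesis.Theorems.FifoMatching.NNNotVP.DivisionSplit (σ NN SuppFn freeVars)
open Summit.ValiantsHypothesis.ValiantsHypothesis.Theorems.FifoMatching.NNDivisionHard.GrandResidualArcs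
  (nnDivisionHard_iff_grandResidualArcs)
open Summit.ValiantsHypothesis.ValiantsHypothesis.Theorems.FifoMatching.NNDivisionHard.NewtonDimension
  (newtonDim_not_certificate_qp)

/-- ★ **BY NAME: `NNDivisionHard` ⟺ grand residual ∧ bounded-arc-set non-generic ∧ high Newton dimension.**
[cite: HrubesYehudayoff2021, §6 Problem 2] -/
theorem nnDivisionHard_iff_grandResidualArcsDim :
    Summit.ValiantsHypothesis.ValiantsHypothesis.Theses.FifoMatching.NNDivisionHard ↔
      ∀ k c : ℕ, ∃ n₀ : ℕ, ∀ n ≥ n₀, ∀ h : MvPolynomial (Fin (2 * n) × Fin (2 * n)) ℝ≥0, h ≠ 0 →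
        complexity h ≤ 2 ^ ((Nat.log 2 n + c) ^ c) →
        (∀ d ∈ h.support, ∀ d' ∈ h.support, vertexDeg d = vertexDeg d') →
        (∀ d ∈ h.support, ∀ s : ℕ,
          s + (2 * ((Nat.log 2 n + c) ^ c + Nat.log 2 n + 1) ^ 6 + 12) ≤ 2 * n →
          ∃ e ∈ d.support,
            (s ≤ e.1.val ∧ e.1.val < s + (2 * ((Nat.log 2 n + c) ^ c + Nat.log 2 n + 1) ^ 6 + 12)) ∨
            (s ≤ e.2.val ∧ e.2.val < s + (2 * ((Nat.log 2 n + c) ^ c + Nat.log 2 n + 1) ^ 6 + 12))) →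
        (∀ e : ℕ, e ≤ 2 ^ ((Nat.log 2 n + k) ^ k) → homogeneousComponent e h = 0) →
        (∀ d ∈ h.support, (Nat.log 2 n + k) ^ k < d.support.card) →
        (∀ T : Finset (σ n), T.card ≤ (Nat.log 2 n + k) ^ k →
          ∃ A : Finset (σ n), SuppFn (freeVars T (NN n)) A ∧ ¬ SuppFn (freeVars T h) A) →
        (∀ I : Finset (Fin (2 * n) × Fin (2 * n)), I.card ≤ k →
          ∀ (d : (Fin (2 * n) × Fin (2 * n)) →₀ ℕ) (a : ℝ≥0), a ≠ 0 →
            topComponent (fun v : Fin (2 * n) × Fin (2 * n) => if v ∈ I then 0 else 1) h ≠ monomial d a) →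
        n < (Module.finrank ℚ (vectorSpan ℚ ((fun u : (Fin (2 * n) × Fin (2 * n)) →₀ ℕ =>
          fun a : Fin (2 * n) × Fin (2 * n) => (u a : ℚ)) '' (h.support : Set ((Fin (2 * n) × Fin (2 * n)) →₀ ℕ))))
          + 1) ^ 2 →
        2 ^ ((Nat.log 2 n + c) ^ c) <
          complexity (nestFreeMatchingPoly n ℝ≥0 * h) + complexity h := by
  constructor
  · intro H k c
    obtain ⟨n₀, hn₀⟩ := H c
    exact ⟨n₀, fun n hn h hh _ _ _ _ _ _ _ _ => hn₀ n hn h hh⟩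
  · intro H
    refine nnDivisionHard_iff_grandResidualArcs.mpr fun k c => ?_
    obtain ⟨n₀, hn₀⟩ := H k c
    obtain ⟨n₁, hn₁⟩ := newtonDim_not_certificate_qp c
    refine ⟨max n₀ n₁, fun n hn h hh hcheap htor hdense hdeep hspread hund hgen => ?_⟩
    by_cases hD : (Module.finrank ℚ (vectorSpan ℚ ((fun u : (Fin (2 * n) × Fin (2 * n)) →₀ ℕ =>
        fun a : Fin (2 * n) × Fin (2 * n) => (u a : ℚ)) '' (h.support : Set ((Fin (2 * n) × Fin (2 * n)) →₀ ℕ))))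
        + 1) ^ 2 ≤ n
    · exact hn₁ n (le_trans (le_max_right _ _) hn) h hh hD
    · exact hn₀ n (le_trans (le_max_left _ _) hn) h hh hcheap htor hdense hdeep hspread hund hgen (not_le.1 hD)

end Summit.ValiantsHypothesis.ValiantsHypothesis.Theorems.FifoMatching.NNDivisionHard.GrandResidualArcsDim

end
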